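import Summits.Ventures.Crystal3D.Theorems.StickyWulffConstantCoaxialWallLawEndRowOuterShellDefs
import HarnessLib

/-!
# Definitions: the FLAT signature-row statistic, the INNER universe and the flat ON-SITE certificate target

HONEST FRAMING. Venture `Summits/Ventures/Crystal3D` (cell `crystal3d-full`), crux `CoaxialWallLaw`
(stmt-Ventures-19481, `route-Ventures-StickyWulffConstant`), REGISTERED line `WallLedgerF` (planner cf-p1), open stub
`stub_coaxialTwoSlabAdhesion`.  DEFINITIONS ONLY; nothing is claimed; F-C1 not moved.  cf-p1 DECISION (xlviii)
(2026-08-28T22:38Z, lane-F tail re-target): (a) the outer-shell reduction is to be stated on the SIGNATURE ROWS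
`localStatSig` of `…EndRowOnSiteDefsA` (PREREG-F-CERT v1.0's row-by-signature on-site fact) as well as on
`localSummandA` (`…EndRowOuterShell`, landed); (b) the CERTIFICATE TARGET OF RECORD becomes the flat on-site fact over
the INNER universe: vacancy sets inside the closed ball `B̄(0, 2]`, outer shell `2 < |x| ≤ 3` occupied, statistic `S♭`.
This file types those objects (19481-p2 keeps the casting vote on which of them the bridge consumes):

* `IsEndPairSigFlat X v Σ b q` — `IsEndPairSig` with the two-payer clause `HasTwoPayers X b` deleted;
  `endMultSigFlat`, `localStatSigFlat X v Σ z` (pooled deficiency `pooledDefFlat` of `…EndRowOuterShellDefs`: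
  `pooledDef + [¬ HasTwoPayers]`);
* `barlowInnerUniverse` — U-IN: patterns `P = (sites of a Barlow stacking in B̄(0,3]) ∖ V` with the vacancy set
  `V` INSIDE `B̄(0, 2]` (any size), payer `0 ∈ P` deficient — no `v_max` (the inner tail is a branch-and-bound
  certificate, (xlviii)(c)); `barlowInnerUniverse_subset`: U-IN patterns with `|V| ≤ vmax` are U-W(`vmax`) patterns;
* `EndRowOnSiteFlatA v s_F 𝒰` — the flat on-site fact: every pattern of `𝒰` has `localStatSigFlat ≤ s_F` at its payer for
  each of the `8` translation and `12` twin signature rows (target of record: `EndRowOnSiteFlatA v2 (9/2) barlowInnerUniverse`);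
* sanity: `isEndPairSigFlat_of_isEndPairSig`, `endMultSig_le_endMultSigFlat_self`, `mem_barlowWindowUniverse_of_inner`
  (the reduction theorem and `EndRowOnSiteFlatA 𝒰 → EndRowOnSiteA 𝒰` are in the sibling file `…EndRowOuterShellSig`).
WHAT THIS IS NOT: no census fact, no reduction theorem (sibling file `…EndRowOuterShellSig`), no bridge; F-C1 not moved.
-/

noncomputable section

namespace Summit.Ventures.Crystal3D.Theorems

open Summit.Ventures.Crystal3D Finset
open Literature.MathematicalPhysics.StatisticalMechanics (barlowStacking IsHaggSeq)
open scoped InnerProductSpace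

section Sig

variable (X : Finset (EuclideanSpace ℝ (Fin 3)))

/-- (A)-END PAIR THROUGH A SIGNATURE, WITHOUT THE TWO-PAYER CLAUSE: `IsEndPairSig` with `HasTwoPayers X b` deleted. -/
def IsEndPairSigFlat (v : WordVersion) (sig : Finset (Bool × EuclideanSpace ℝ (Fin 3))) (b q : EuclideanSpace ℝ (Fin 3)) :
    Prop :=
  q ∈ X ∧ b ∈ X ∧ ∃ σ ∈ sig, q - sigDir σ ∈ X ∧ IsEndMove X v (sigFrame σ.1) (sigDir σ) q b

open scoped Classical in
/-- FLAT END MULTIPLICITY of `b` through the signatures `Σ`. -/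
def endMultSigFlat (v : WordVersion) (sig : Finset (Bool × EuclideanSpace ℝ (Fin 3))) (b : EuclideanSpace ℝ (Fin 3)) : ℕ :=
  (X.filter fun q => IsEndPairSigFlat X v sig b q).card

open scoped Classical in
/-- THE FLAT LOCAL STATISTIC through the signatures `Σ` at the payer `z`: flat multiplicities over flat pools. -/
def localStatSigFlat (v : WordVersion) (sig : Finset (Bool × EuclideanSpace ℝ (Fin 3))) (z : EuclideanSpace ℝ (Fin 3)) :
    ℝ :=
  ∑ b ∈ X.filter (fun b => dist z b ≤ 1 ∧ 0 < endMultSigFlat X v sig b),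
    (endMultSigFlat X v sig b : ℝ) / pooledDefFlat X b

end Sig

open scoped Classical in
/-- **THE INNER UNIVERSE U-IN**: patterns `P = (sites of a Barlow stacking in the closed ball B̄(0,3]) ∖ V` whose vacancy
set `V` lies INSIDE the closed ball `B̄(0, 2]` (any number of vacancies; the outer shell `2 < |x| ≤ 3` is occupied),
with the payer `0 ∈ P` deficient. -/
def barlowInnerUniverse : Set (Finset (EuclideanSpace ℝ (Fin 3))) :=
  {P | ∃ s : ℤ → ℤ, IsHaggSeq s ∧ ∃ V : Finset (EuclideanSpace ℝ (Fin 3)),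
    (↑V : Set (EuclideanSpace ℝ (Fin 3))) ⊆ barlowStacking 1 (Real.sqrt (2 / 3)) s ∩ Metric.closedBall 0 2 ∧
    (↑P : Set (EuclideanSpace ℝ (Fin 3))) =
      (barlowStacking 1 (Real.sqrt (2 / 3)) s ∩ Metric.closedBall 0 3) \ ↑V ∧
    (0 : EuclideanSpace ℝ (Fin 3)) ∈ P ∧ (P.filter fun q => dist (0 : EuclideanSpace ℝ (Fin 3)) q = 1).card ≤ 11}

/-- An inner pattern with at most `vmax` vacancies is a U-W(`vmax`) pattern. -/
theorem mem_barlowWindowUniverse_of_inner {vmax : ℕ} {P : Finset (EuclideanSpace ℝ (Fin 3))}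
    (h : P ∈ barlowInnerUniverse) (hcard : ∃ s : ℤ → ℤ, IsHaggSeq s ∧ ∃ V : Finset (EuclideanSpace ℝ (Fin 3)),
      V.card ≤ vmax ∧ (↑V : Set (EuclideanSpace ℝ (Fin 3))) ⊆ barlowStacking 1 (Real.sqrt (2 / 3)) s ∩ Metric.closedBall 0 2 ∧
      (↑P : Set (EuclideanSpace ℝ (Fin 3))) = (barlowStacking 1 (Real.sqrt (2 / 3)) s ∩ Metric.closedBall 0 3) \ ↑V) :
    P ∈ barlowWindowUniverse vmax := by
  obtain ⟨-, -, -, -, -, h0, hdeg⟩ := h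
  obtain ⟨s, hs, V, hV, hVs, hP⟩ := hcard
  exact ⟨s, hs, V, hV, fun x hx => (hVs hx).1, hP, h0, hdeg⟩

/-- **THE FLAT ON-SITE FACT** for the universe `𝒰` at version `v` and constant `s_F`: every pattern has flat local statistic
`≤ s_F` at its payer `0` for each of the `8` translation and `12` twin signature rows.  Certificate target of record
(cf-p1 (xlviii)(b)): `EndRowOnSiteFlatA WordVersion.v2 (9/2) barlowInnerUniverse`. -/
def EndRowOnSiteFlatA (v : WordVersion) (sF : ℝ) (𝒰 : Set (Finset (EuclideanSpace ℝ (Fin 3)))) : Prop :=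
  ∀ P ∈ 𝒰,
    (∀ ε : Bool, ∀ n ∈ modelNormals, localStatSigFlat P v (transSigs ε n) 0 ≤ sF) ∧
    (∀ ε : Bool, ∀ h ∈ basalHexagon, localStatSigFlat P v (twinSigs ε h) 0 ≤ sF)

/-! ### Same-configuration comparisons -/

section Self

variable {X : Finset (EuclideanSpace ℝ (Fin 3))} {v : WordVersion} {sig : Finset (Bool × EuclideanSpace ℝ (Fin 3))}

/-- A signature end pair is a flat signature end pair of the same configuration. -/
theorem isEndPairSigFlat_of_isEndPairSig {b q : EuclideanSpace ℝ (Fin 3)} (h : IsEndPairSig X v sig b q) :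
    IsEndPairSigFlat X v sig b q := by
  obtain ⟨hq, hb, -, σ, hσ, hpred, hmove⟩ := h
  exact ⟨hq, hb, σ, hσ, hpred, hmove⟩

open scoped Classical in
/-- `endMultSig ≤ endMultSigFlat` on the same configuration. -/
theorem endMultSig_le_endMultSigFlat_self (b : EuclideanSpace ℝ (Fin 3)) :
    endMultSig X v sig b ≤ endMultSigFlat X v sig b := by
  unfold endMultSig endMultSigFlat
  exact card_le_card fun q hq => by
    rw [mem_filter] at hq ⊢
    exact ⟨hq.1, isEndPairSigFlat_of_isEndPairSig hq.2⟩

end Self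

end Summit.Ventures.Crystal3D.Theorems

end
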